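import Literature.MathematicalPhysics.QuantumFieldTheory.Balaban1983to89.B9Eq352DivForm
import Literature.MathematicalPhysics.QuantumFieldTheory.Balaban1983to89.B9Ineq386CommSum

/-!
# `Balaban1983to89.B9Eq352DivFormLetters` — B9 pp. 400–407: the commutator letters of (3.52) AS LETTERS OF THE
# BLOCK-MAJORANT CALCULUS — real coordinates of a finite-dimensional `𝔸` (the seam between the `𝔸`-valued lattice
# calculus of `B9Eq352DivForm` and the `W → ℝ` majorants of [4] (2.51)), the operator identities `V¹∇ − ∇V¹ = −ad_{∇a}∘τ`,
# and the hypothesis shape `hComm : [V¹_k, ∇_k] ≺ c_Kα₁(Lʲη)⁻²e^{−δd}` of `B9Ineq386CommSum` DISCHARGED for the concrete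
# letters under (3.37)

statement-level skeleton of published theorems with citation tags; proofs where landed; nothing here is a claim about the Yang–Mills mass gap

CITATION HEADER (lean-in-tree rule).  T. Bałaban, *Propagators for lattice gauge theories in a background field*, Commun.
Math. Phys. **99** (1985) 389–434 [Balaban1985BackgroundPropagators] (cell paper B9; `paper:balaban1985-cmp99-background-
propagators`, journal page = PDF page + 388): p. 400 [PDF 12] (3.52) (render `…-p012-x2.png` read as image by this seat),
p. 396 [PDF 8] (3.37) («|A′| < α₁(Lʲη)⁻¹, |∇^η_UA′| < α₁(Lʲη)⁻² on Ω_j»), p. 405 [PDF 17] (3.73) and «The derivatives are, of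
course, the covariant derivatives defined by U», p. 398 [PDF 10] remarks after Theorem 3.1; [4] = T. Bałaban, *Propagators
and renormalization transformations for lattice gauge theories. II*, Commun. Math. Phys. **96** (1984) 223–250
[Balaban1984PropagatorsII], (2.51) p. 232 («|(Rλ)(x)| ≦ O(M⁻¹)e^{−δ₀d(x,y)}|λ| if supp λ ⊂ B^j(y)» — the majorant SHAPE,
typed by pv08 as `B6RandomWalk.HasMajorant` over REAL-valued lattice functions); [B8] = T. Bałaban, *Spaces of regular
gauge field configurations on a lattice and gauge fixing conditions*, Commun. Math. Phys. **99** (1985) 75–102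
[Balaban1985RegularSpaces], (1.86)–(1.87) p. 91 (the lattice Leibniz rule).  Cell `lit-balaban`, seat r06 (B9 fold owner)
gen 8, third file of the gen; SKELETON rows **B9.Eq3.50/3.54** × **B9.Eq3.85** / **B9.Eq3.68** (the `hComm` letters).
Continuation of the same seat's `B9Eq352DivForm` (p260065: `adOp`, `tauF`, `tauB`, `ad_smul_covD_eq`, `ad_smul_covDstar_eq`,
`commPart`, `norm_commPart_le` — used BY NAME) and `B9Ineq386CommSum` (p260368: `hasMajorant_of_local` — used BY NAME).

WHY (the seam this closes).  The cell's B9 Sect. B chain is kernel-checked in pv08's block-majorant calculus over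
real-valued lattice functions `W → ℝ` (`HasMajorant blk T K`: «|(Tλ)(x)| ≦ K(y,y′)|λ| for x ∈ Δ(y), supp λ ⊂ Δ(y′)»), while the
concrete operators of (3.50)–(3.54) act on `𝔸`-valued functions `S → 𝔸` (`B9Eq39Adjoint`, `B9Eq352ScalarFluct`,
`B9Eq352DivForm`).  Several seats recorded the passage between the two as «NOT bridged: a choice of basis of 𝔤» (p06 g5
`B9Ineq3137From149`; this seat's gen-8 files (ii)).  For a finite-dimensional `𝔸` (the groups of the series: `𝔸 = M_N(ℂ) ⊃
𝔤^c`) the passage is a conjugation by real coordinates, and the only analytic content is the equivalence of the coordinate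
sup-norm with the norm of `𝔸`, with basis-dependent constants.  This file writes that down once and pushes the commutator
letters of `B9Eq352DivForm` through it, so that the hypothesis `hComm k` of `B9Ineq386CommSum.thm34_G_entries13_opForm_of_comm_sum`
(and of `B9Ineq368PPrimeDs` §5, `B9Ineq386RightEntry` §5) is available AS A THEOREM for the concrete letters.

WHAT THIS FILE PROVES (0 sorry; definitions with bodies + theorems; no `def … : Prop`).
* §1 REAL COORDINATES (any real normed space `E` with a finite basis `b : Module.Basis ι ℝ E`, any site set `S`):
  `coordEquiv b : (S → E) ≃ₗ[ℝ] (S × ι → ℝ)` (`f ↦ ((x,i) ↦ b.repr (f x) i)`, inverse `μ ↦ (x ↦ Σ_i μ(x,i)·b_i)`), `conj b T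
  := (coordEquiv b).conj T` for `T : Module.End ℝ (S → E)` with `conj_apply`, `conj_mul`, `conj_sub`, `conj_neg`; the norm
  comparison `norm_coordSymm_apply_le` (`‖Σ_i μ(x,i)b_i‖ ≦ (Σ_i‖b_i‖)·max_i|μ(x,i)|`) and `exists_repr_bound` (∃ `M₂ ≧ 0`,
  `|b.repr v i| ≦ M₂‖v‖` — finite dimension); **`hasMajorant_conj_of_local`** — THE SEAM: if `‖(Tf)(x)‖ ≦ c(y)·sup_{near x}‖f‖`
  (stencil in blocks at `d`-distance `≦ d₀` of the block `y` of `x`) then `conj b T ≺ c(y)·M₂Σ_i‖b_i‖·e^{δd₀}·e^{−δd(y,y′)}`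
  with respect to the block map `(x,i) ↦ y(x)` (via `B9Ineq386CommSum.hasMajorant_of_local`); `hasMajorant_conj_of_local'`
  (stencil inside the block: block-diagonal).
* §2 THE CONCRETE LETTERS of (3.52) as `ℝ`-linear operators on `S → 𝔸` (carrier of `B9Eq39Adjoint`; `𝔸` a normed
  `ℂ`-algebra, `ℝ`-structure by restriction of scalars): `mulLetter a` (`λ ↦ i[a(x), λ(x)]`, the coefficient `iad_{A′(b)}`),
  `gradLetterF c μ` / `gradLetterB c μ` (`λ ↦ c·D¹_μλ`, `c·D¹*_μλ`; `c = η⁻¹`: `∇_μ`, `∇*_μ`), `commLetterF c μ a` / `commLetterB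
  c μ a` (`λ ↦ i[(c·D¹_μa)(x), τ_μλ(x)]`, `i[(c·D¹*_μa)(x), τ*_μλ(x)]`); the OPERATOR identities **`mul_grad_comm_F`** /
  **`mul_grad_comm_B`**: `mulLetter a * gradLetterF c μ − gradLetterF c μ * mulLetter a = −commLetterF c μ a` (and backward)
  — `[V¹, ∇] = −ad_{∇a}∘τ` as an identity in `Module.End ℝ (S → 𝔸)` (pointwise = `B9Eq352DivForm.ad_smul_covD_eq`);
  `commPart_eq_sum_letters` (`B9Eq352DivForm.commPart` = `Σ_μ (commLetterF η⁻¹ μ (A μ) − commLetterB η⁻¹ μ (τ*_μA_μ))`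
  applied to `λ`).
* §3 THE LETTERS IN THE BLOCK-MAJORANT CALCULUS (finite-dimensional `𝔸` with real basis `b`): `norm_commLetterF_le` /
  `norm_commLetterB_le` (pointwise: `≦ 2ρ²·g(y)·‖λ(x±e_μ)‖` when the coefficient difference at `x ∈ Δ(y)` has norm `≦ g(y)`
  and the transports size `≦ ρ`); **`hasMajorant_commLetterF`** / **`hasMajorant_commLetterB`**; and the printed regime
  **`hasMajorant_comm_forward`** / **`hasMajorant_comm_backward`**: under (3.37) read blockwise (`‖(η⁻¹D¹_μA_μ)(x)‖ ≦
  α₁(Lʲη)⁻²` for `x ∈ Δ(y)`, `y ∈ Λ_j`; resp. the starred coefficient difference), transports of size `≦ ρ` and neighbouring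
  blocks at `d`-distance `≦ d₀`,
  `conj b (mulLetter (A μ)) * conj b (gradLetterF η⁻¹ μ) − conj b (gradLetterF η⁻¹ μ) * conj b (mulLetter (A μ))
   ≺ c_K·α₁·(Lʲη)⁻²·e^{−δd(y,y′)}`, `c_K = 2ρ²·M₂·(Σ_i‖b_i‖)·e^{δd₀}` — EXACTLY the hypothesis `hComm k` of
  `B9Ineq386CommSum.thm34_G_entries13_opForm_of_comm_sum` for the letters `V1 k := conj b (mulLetter (A μ))`, `D k := conj b
  (gradLetterF η⁻¹ μ)` (forward bonds) and their backward twins.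

HONEST SCOPE / NOT CLAIMED.  (i) Finite-dimensional `𝔸` only (a real basis is a hypothesis-free datum `b`; for the groups
of the series `𝔸 = M_N(ℂ)`); the constants `M₂`, `Σ‖b_i‖`, `e^{δd₀}` are basis/geometry bookkeeping invisible in the print's
`O(1)`.  (ii) The OTHER hypotheses of the abstract chain (Theorem 3.3's entries `∇_kG(U)`, `G(U)∇_k` for `G(U)`, the letters
`P₁`, `P₂`, `Δ_a(U)G(U) = 1`, the scale transfers and (2.61)) are NOT touched: they are the bootstrap inputs of Sect. B
(p. 402 «We assume that Theorem 3.1 is valid …», p. 407 «assuming that Theorems 3.1–3.3 hold»); this file discharges the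
commutator letters only, and records the dictionary by which any other pointwise-local concrete letter (the coefficients
`V¹_k = iad_{A}`: `hasMajorant_mulLetter`) enters.  (iii) Block geometry enters as the two located hypotheses «x and x ± e_μ
lie in blocks at d-distance ≦ d₀» and «(3.37) holds with the scale of the block of x» (p. 398: «we can take either Lʲη, or
L^{j′}η … this changes the constant δ₀ only»).  (iv) Sup-norm reading of `|λ|` = max over real coordinates (the cell's
`W → ℝ` convention); the `𝔸`-norm reading differs by the constants of §1.  Value = the recorded seam closed for the
commutator letters, kernel-checked; NOT summit progress.

RELATED IN THE TREE, NOT DUPLICATED (searched 2026-08-21: `lean search 'coordEquiv|conj_of_local'` in Balaban1983to89 = ∅;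
`B11KernelDictionary` (pv lineage) is the kernel ⟺ majorant dictionary for REAL kernels `kernelOp`, no vector-valued
coordinates; `B9Ineq366CPrime.hasMajorant_local_mul` consumes block-diagonal letters; `B9Ineq386CommSum.hasMajorant_of_local`
is the abstract-carrier dictionary this file instantiates).
-/

noncomputable section

namespace Literature.MathematicalPhysics.QuantumFieldTheory.Balaban1983to89.B9Eq352DivFormLetters

open Complex
open Literature.MathematicalPhysics.QuantumFieldTheory.Balaban1983to89
open Literature.MathematicalPhysics.QuantumFieldTheory.Balaban1983to89.B6RandomWalk (HasMajorant BlockSupp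
  hasMajorant_mono hasMajorant_add)
open Literature.MathematicalPhysics.QuantumFieldTheory.Balaban1983to89.B9Thm34Ext (toB6)
open Literature.MathematicalPhysics.QuantumFieldTheory.Balaban1983to89.Beta.BackgroundVertices (ad norm_ad_le ad_smul_left
  ad_smul_right ad_add_right ad_sub_right ad_apply)
open Literature.MathematicalPhysics.QuantumFieldTheory.Balaban1983to89.B9Eq39Adjoint
open Literature.MathematicalPhysics.QuantumFieldTheory.Balaban1983to89.B9Eq370Expansion (norm_R_le)
open Literature.MathematicalPhysics.QuantumFieldTheory.Balaban1983to89.B9Eq352DivForm (adOp tauF tauB adOp_apply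
  tauF_apply tauB_apply ad_smul_covD_eq ad_smul_covDstar_eq commPart)
open Literature.MathematicalPhysics.QuantumFieldTheory.Balaban1983to89.B9Ineq386CommSum (hasMajorant_of_local
  hasMajorant_of_local')
open Literature.MathematicalPhysics.QuantumFieldTheory.Balaban1983to89.B9Ineq368PPrime (hasMajorant_neg)

/-! ## §1  Real coordinates: `(S → E) ≃ (S × ι → ℝ)` and the seam lemma -/

section Coordinates

variable {E : Type*} [NormedAddCommGroup E] [NormedSpace ℝ E] {ι : Type} [Fintype ι] {S : Type}
variable (b : Module.Basis ι ℝ E)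

/-- **Real coordinates of `E`-valued lattice functions**: `f ↦ ((x, i) ↦ (b.repr (f x)) i)` with inverse `μ ↦ (x ↦ Σ_i
μ(x,i)·b_i)` — the cell's `W → ℝ` carrier (`W = S × ι`) for vector-valued lattice functions. [folklore]
[cite: Balaban1984PropagatorsII, (2.51) p.232] -/
def coordEquiv : (S → E) ≃ₗ[ℝ] (S × ι → ℝ) where
  toFun f := fun p => b.repr (f p.1) p.2
  invFun μ := fun x => b.equivFun.symm fun i => μ (x, i)
  map_add' f f' := by
    funext p
    simp only [Pi.add_apply, map_add, Finsupp.coe_add]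
  map_smul' r f := by
    funext p
    simp only [Pi.smul_apply, map_smul, Finsupp.coe_smul, smul_eq_mul, RingHom.id_apply]
  left_inv f := by
    funext x
    simp only
    rw [Module.Basis.equivFun_symm_apply, Module.Basis.sum_repr]
  right_inv μ := by
    funext p
    have h := b.equivFun.apply_symm_apply fun i => μ (p.1, i)
    have h' := congrFun h p.2
    rw [Module.Basis.equivFun_apply] at h'
    simpa using h'

/-- Unfolding the coordinates (elementary API for the (2.51) reading of vector-valued lattice functions). [folklore]
[cite: Balaban1984PropagatorsII, (2.51) p.232] -/
theorem coordEquiv_apply (f : S → E) (p : S × ι) : coordEquiv b f p = b.repr (f p.1) p.2 := rfl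

/-- Unfolding the inverse: `((coordEquiv b).symm μ)(x) = Σ_i μ(x,i)·b_i` (elementary API for the (2.51) reading). [folklore]
[cite: Balaban1984PropagatorsII, (2.51) p.232] -/
theorem coordEquiv_symm_apply (μ : S × ι → ℝ) (x : S) :
    (coordEquiv b).symm μ x = ∑ i, μ (x, i) • b i := by
  show b.equivFun.symm (fun i => μ (x, i)) = _
  rw [Module.Basis.equivFun_symm_apply]

/-- **The conjugate of an `ℝ`-linear lattice operator by the coordinates**: `conj b T = coord ∘ T ∘ coord⁻¹`, an endomorphism
of the cell's real-valued carrier `S × ι → ℝ` (`LinearEquiv.conj`). [folklore] [cite: Balaban1984PropagatorsII, (2.51) p.232] -/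
def conj (T : Module.End ℝ (S → E)) : Module.End ℝ (S × ι → ℝ) := (coordEquiv b).conj T

/-- Unfolding `conj`: `(conj b T μ)(x,i) = b.repr ((T (coord⁻¹μ))(x)) i` (elementary API for the (2.51) reading). [folklore]
[cite: Balaban1984PropagatorsII, (2.51) p.232] -/
theorem conj_apply (T : Module.End ℝ (S → E)) (μ : S × ι → ℝ) (p : S × ι) :
    conj b T μ p = b.repr (T ((coordEquiv b).symm μ) p.1) p.2 := by
  rw [conj, LinearEquiv.conj_apply_apply, coordEquiv_apply]

/-- `conj` is multiplicative (conjugation is an algebra homomorphism; [4] (2.52)–(2.55): compositions of letters). [folklore]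
[cite: Balaban1984PropagatorsII, (2.52)–(2.55) p.232] -/
theorem conj_mul (T₁ T₂ : Module.End ℝ (S → E)) : conj b (T₁ * T₂) = conj b T₁ * conj b T₂ := by
  rw [conj, conj, conj, Module.End.mul_eq_comp, Module.End.mul_eq_comp, LinearEquiv.conj_comp]

/-- `conj` respects differences ([4] p.232 «A summation preserves it also»). [folklore]
[cite: Balaban1984PropagatorsII, (2.52) p.232] -/
theorem conj_sub (T₁ T₂ : Module.End ℝ (S → E)) : conj b (T₁ - T₂) = conj b T₁ - conj b T₂ := by
  simp only [conj, map_sub]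

/-- `conj (−T) = −conj T`. [folklore] [cite: Balaban1984PropagatorsII, (2.52) p.232] -/
theorem conj_neg (T : Module.End ℝ (S → E)) : conj b (-T) = -conj b T := by
  simp only [conj, map_neg]

/-- **Norm comparison, synthesis side**: if `|μ(x,i)| ≦ B` for all `i` then `‖(coord⁻¹μ)(x)‖ = ‖Σ_i μ(x,i)b_i‖ ≦ (Σ_i‖b_i‖)·B`
(the `|λ|` of (2.51) read over real coordinates versus the norm of `E`). [folklore] [cite: Balaban1984PropagatorsII, (2.51) p.232] -/
theorem norm_coordSymm_apply_le (μ : S × ι → ℝ) (x : S) (B : ℝ) (h : ∀ i, |μ (x, i)| ≤ B) :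
    ‖(coordEquiv b).symm μ x‖ ≤ (∑ i, ‖b i‖) * B := by
  rw [coordEquiv_symm_apply]
  calc ‖∑ i, μ (x, i) • b i‖ ≤ ∑ i, ‖μ (x, i) • b i‖ := norm_sum_le _ _
    _ ≤ ∑ i, ‖b i‖ * B := Finset.sum_le_sum fun i _ => by
        rw [norm_smul, Real.norm_eq_abs, mul_comm]
        exact mul_le_mul_of_nonneg_left (h i) (norm_nonneg _)
    _ = (∑ i, ‖b i‖) * B := by rw [Finset.sum_mul]

/-- **Norm comparison, analysis side**: in finite dimension the coordinate functionals are bounded — ∃ `M₂ ≧ 0` with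
`|b.repr v i| ≦ M₂‖v‖` for all `v`, `i` (`M₂` = the operator norm of `Module.Basis.equivFunL`; the `|λ|` of (2.51) over real
coordinates versus the norm of `E`). [folklore] [cite: Balaban1984PropagatorsII, (2.51) p.232] -/
theorem exists_repr_bound : ∃ M₂ : ℝ, 0 ≤ M₂ ∧ ∀ (v : E) (i : ι), |b.repr v i| ≤ M₂ * ‖v‖ := by
  refine ⟨‖(b.equivFunL : E →L[ℝ] (ι → ℝ))‖, norm_nonneg _, fun v i => ?_⟩
  have h1 : |b.repr v i| ≤ ‖b.equivFunL v‖ := by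
    have := norm_le_pi_norm (b.equivFunL v) i
    rw [Real.norm_eq_abs] at this
    simpa [Module.Basis.equivFunL_apply] using this
  exact h1.trans ((b.equivFunL : E →L[ℝ] (ι → ℝ)).le_opNorm v)

variable {g : B9.Geometry} [Fintype g.Site] {Rr : ℝ} {H : Prop}

/-- **THE SEAM: a stencil-local operator on `E`-valued lattice functions is a letter of the block-majorant calculus after
conjugation by real coordinates.**  If `‖(Tf)(x)‖ ≦ c(y)·B` whenever `‖f(x′)‖ ≦ B` at the stencil points `x′` of `x` (`y` the
block of `x`, `c ≧ 0`), the stencil of `x` lies in blocks at `d`-distance `≦ d₀` from `y`, and `|b.repr v i| ≦ M₂‖v‖`, then for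
every `δ ≧ 0`: `conj b T ≺ c(y)·M₂·(Σ_i‖b_i‖)·e^{δd₀}·e^{−δd(y,y′)}` with respect to the block map `(x,i) ↦ y(x)` — the shape
(2.51) of [4].  Proof: `B9Ineq386CommSum.hasMajorant_of_local` on the carrier `S × ι` with the stencil `(x,i) ~ (x′,j) :⟺ x ~
x′` and the two norm comparisons.
[cite: Balaban1984PropagatorsII, (2.51) p.232; Balaban1985BackgroundPropagators, (3.73) p.405 + (3.37) p.396] -/
theorem hasMajorant_conj_of_local (blk : S → g.Site) (near : S → S → Prop) (c : g.Site → ℝ) (d₀ δ M₂ : ℝ)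
    (hc : ∀ a, 0 ≤ c a) (hδ : 0 ≤ δ) (hM₂ : 0 ≤ M₂) (hrepr : ∀ (v : E) (i : ι), |b.repr v i| ≤ M₂ * ‖v‖)
    (hnear : ∀ x x', near x x' → g.dist (blk x) (blk x') ≤ d₀)
    (T : Module.End ℝ (S → E))
    (hT : ∀ (f : S → E) (x : S) (B : ℝ), (∀ x', near x x' → ‖f x'‖ ≤ B) → ‖T f x‖ ≤ c (blk x) * B) :
    HasMajorant (g := toB6 g Rr H) (fun p : S × ι => blk p.1) (conj b T)
      (fun a a' => c a * (M₂ * ∑ i, ‖b i‖) * Real.exp (δ * d₀) * Real.exp (-(δ * g.dist a a'))) := by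
  have hSb : 0 ≤ ∑ i, ‖b i‖ := Finset.sum_nonneg fun i _ => norm_nonneg _
  refine hasMajorant_of_local (R := Rr) (H := H) (fun p : S × ι => blk p.1) (fun p q => near p.1 q.1)
    (fun a => c a * (M₂ * ∑ i, ‖b i‖)) d₀ δ (fun a => mul_nonneg (hc a) (mul_nonneg hM₂ hSb)) hδ
    (fun p q hpq => hnear p.1 q.1 hpq) ?_
  intro μ p B hB
  -- the test function in `E`-valued form and its stencil bound
  have hf : ∀ x', near p.1 x' → ‖(coordEquiv b).symm μ x'‖ ≤ (∑ i, ‖b i‖) * B := fun x' hx' =>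
    norm_coordSymm_apply_le b μ x' B fun i => hB (x', i) hx'
  have h1 : ‖T ((coordEquiv b).symm μ) p.1‖ ≤ c (blk p.1) * ((∑ i, ‖b i‖) * B) := hT _ p.1 _ hf
  rw [conj_apply]
  calc |b.repr (T ((coordEquiv b).symm μ) p.1) p.2|
      ≤ M₂ * ‖T ((coordEquiv b).symm μ) p.1‖ := hrepr _ _
    _ ≤ M₂ * (c (blk p.1) * ((∑ i, ‖b i‖) * B)) := mul_le_mul_of_nonneg_left h1 hM₂
    _ = c (blk p.1) * (M₂ * ∑ i, ‖b i‖) * B := by ring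

/-- **The seam for block-local letters** (stencil inside the block of `x`, e.g. the pointwise coefficient `iad_{A(x)}`):
`conj b T ≺ c(y)·M₂·(Σ_i‖b_i‖)·𝟙[y = y′]`. [cite: Balaban1984PropagatorsII, (2.51) p.232; Balaban1985BackgroundPropagators, (3.52) p.400] -/
theorem hasMajorant_conj_of_local' [DecidableEq g.Site] (blk : S → g.Site) (near : S → S → Prop) (c : g.Site → ℝ)
    (M₂ : ℝ) (hM₂ : 0 ≤ M₂) (hrepr : ∀ (v : E) (i : ι), |b.repr v i| ≤ M₂ * ‖v‖)
    (hnear : ∀ x x', near x x' → blk x' = blk x) (T : Module.End ℝ (S → E))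
    (hT : ∀ (f : S → E) (x : S) (B : ℝ), (∀ x', near x x' → ‖f x'‖ ≤ B) → ‖T f x‖ ≤ c (blk x) * B) :
    HasMajorant (g := toB6 g Rr H) (fun p : S × ι => blk p.1) (conj b T)
      (fun a a' : g.Site => if a = a' then c a * (M₂ * ∑ i, ‖b i‖) else 0) := by
  refine hasMajorant_of_local' (R := Rr) (H := H) (fun p : S × ι => blk p.1) (fun p q => near p.1 q.1)
    (fun a => c a * (M₂ * ∑ i, ‖b i‖)) (fun p q hpq => hnear p.1 q.1 hpq) ?_
  intro μ p B hB
  have hf : ∀ x', near p.1 x' → ‖(coordEquiv b).symm μ x'‖ ≤ (∑ i, ‖b i‖) * B := fun x' hx' =>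
    norm_coordSymm_apply_le b μ x' B fun i => hB (x', i) hx'
  have h1 : ‖T ((coordEquiv b).symm μ) p.1‖ ≤ c (blk p.1) * ((∑ i, ‖b i‖) * B) := hT _ p.1 _ hf
  rw [conj_apply]
  calc |b.repr (T ((coordEquiv b).symm μ) p.1) p.2|
      ≤ M₂ * ‖T ((coordEquiv b).symm μ) p.1‖ := hrepr _ _
    _ ≤ M₂ * (c (blk p.1) * ((∑ i, ‖b i‖) * B)) := mul_le_mul_of_nonneg_left h1 hM₂
    _ = c (blk p.1) * (M₂ * ∑ i, ‖b i‖) * B := by ring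

end Coordinates

/-! ## §2  The concrete letters of (3.52) as `ℝ`-linear operators and the operator identities `[V¹, ∇] = −ad_{∇a}∘τ` -/

section Letters

variable {𝔸 : Type*} [NormedRing 𝔸] [NormedAlgebra ℂ 𝔸] {S : Type} {κ : Type*}
variable (T : κ → Equiv.Perm S) (U : κ → S → 𝔸ˣ)

omit [NormedAlgebra ℂ 𝔸] in
/-- `R(V)(r·X) = r·R(V)X` for REAL scalars (restriction of scalars). [folklore] -/
private theorem R_real_smul [NormedAlgebra ℂ 𝔸] (V : 𝔸ˣ) (r : ℝ) (X : 𝔸) : R V (r • X) = r • R V X := by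
  rw [R_def, R_def, mul_smul_comm, smul_mul_assoc]

/-- **The coefficient letter `V¹ = iad_{a}`**: `λ ↦ (x ↦ i[a(x), λ(x)])`, `ℝ`-linear in `λ` (the letter `iad_{A′(b)}` of (3.52),
`iad_{A_ν(x)}` of (3.71)). [cite: Balaban1985BackgroundPropagators, (3.52) p.400] -/
def mulLetter (a : S → 𝔸) : Module.End ℝ (S → 𝔸) where
  toFun lam := fun x => (I : ℂ) • adOp a lam x
  map_add' lam lam' := by
    funext x
    simp only [adOp_apply, Pi.add_apply, ad_add_right, smul_add]
  map_smul' r lam := by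
    funext x
    simp only [adOp_apply, Pi.smul_apply, RingHom.id_apply]
    rw [ad_smul_right, smul_comm]

/-- **The difference letter `∇_μ = η⁻¹D¹_μ`** (forward covariant difference, (3.3)): `λ ↦ (x ↦ c·(D¹_μλ)(x))`, `c = η⁻¹`.
[cite: Balaban1985BackgroundPropagators, (3.3) p.390] -/
def gradLetterF (c : ℂ) (μ : κ) : Module.End ℝ (S → 𝔸) where
  toFun lam := fun x => c • covD T U μ lam x
  map_add' lam lam' := by
    funext x
    simp only [Pi.add_apply, covD_add, smul_add]
  map_smul' r lam := by
    funext x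
    simp only [Pi.smul_apply, RingHom.id_apply]
    rw [← Complex.coe_smul, covD_smul, Complex.coe_smul, smul_comm]

/-- **The difference letter `∇*_μ = η⁻¹D¹*_μ`** (backward covariant difference, (3.8)): `λ ↦ (x ↦ c·(D¹*_μλ)(x))`.
[cite: Balaban1985BackgroundPropagators, (3.8) p.392] -/
def gradLetterB (c : ℂ) (μ : κ) : Module.End ℝ (S → 𝔸) where
  toFun lam := fun x => c • covDstar T U μ lam x
  map_add' lam lam' := by
    funext x
    simp only [Pi.add_apply, covDstar_add, smul_add]
  map_smul' r lam := by
    funext x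
    simp only [Pi.smul_apply, RingHom.id_apply]
    rw [← Complex.coe_smul, covDstar_smul, Complex.coe_smul, smul_comm]

/-- **The forward commutator letter `ad_{∇_μa}∘τ_μ`**: `λ ↦ (x ↦ i[(c·D¹_μa)(x), (τ_μλ)(x)])` (the forward term of
`B9Eq352DivForm.commPart`). [cite: Balaban1985BackgroundPropagators, (3.52) p.400 + (3.37) p.396; Balaban1985RegularSpaces, (1.87) p.91] -/
def commLetterF (c : ℂ) (μ : κ) (a : S → 𝔸) : Module.End ℝ (S → 𝔸) where
  toFun lam := fun x => (I : ℂ) • ad (c • covD T U μ a x) (tauF T U μ lam x)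
  map_add' lam lam' := by
    funext x
    simp only [tauF_apply, Pi.add_apply, R_add, ad_add_right, smul_add]
  map_smul' r lam := by
    funext x
    simp only [tauF_apply, Pi.smul_apply, RingHom.id_apply]
    rw [R_real_smul, ad_smul_right, smul_comm]

/-- **The backward commutator letter `ad_{∇*_μa}∘τ*_μ`**: `λ ↦ (x ↦ i[(c·D¹*_μa)(x), (τ*_μλ)(x)])` (the backward term of
`B9Eq352DivForm.commPart`, there with the coefficient `a = τ*_μA_μ`). [cite: Balaban1985BackgroundPropagators, (3.52) p.400 + (3.37) p.396; Balaban1985RegularSpaces, (1.87) p.91] -/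
def commLetterB (c : ℂ) (μ : κ) (a : S → 𝔸) : Module.End ℝ (S → 𝔸) where
  toFun lam := fun x => (I : ℂ) • ad (c • covDstar T U μ a x) (tauB T U μ lam x)
  map_add' lam lam' := by
    funext x
    simp only [tauB_apply, Pi.add_apply, R_add, ad_add_right, smul_add]
  map_smul' r lam := by
    funext x
    simp only [tauB_apply, Pi.smul_apply, RingHom.id_apply]
    rw [R_real_smul, ad_smul_right, smul_comm]

/-- Unfolding `mulLetter`. [cite: Balaban1985BackgroundPropagators, (3.52) p.400] -/
theorem mulLetter_apply (a lam : S → 𝔸) (x : S) : mulLetter a lam x = (I : ℂ) • ad (a x) (lam x) := rfl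

/-- Unfolding `gradLetterF`. [cite: Balaban1985BackgroundPropagators, (3.3) p.390] -/
theorem gradLetterF_apply (c : ℂ) (μ : κ) (lam : S → 𝔸) (x : S) :
    gradLetterF T U c μ lam x = c • covD T U μ lam x := rfl

/-- Unfolding `gradLetterB`. [cite: Balaban1985BackgroundPropagators, (3.8) p.392] -/
theorem gradLetterB_apply (c : ℂ) (μ : κ) (lam : S → 𝔸) (x : S) :
    gradLetterB T U c μ lam x = c • covDstar T U μ lam x := rfl

/-- Unfolding `commLetterF`. [cite: Balaban1985BackgroundPropagators, (3.52) p.400] -/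
theorem commLetterF_apply (c : ℂ) (μ : κ) (a lam : S → 𝔸) (x : S) :
    commLetterF T U c μ a lam x = (I : ℂ) • ad (c • covD T U μ a x) (tauF T U μ lam x) := rfl

/-- Unfolding `commLetterB`. [cite: Balaban1985BackgroundPropagators, (3.52) p.400] -/
theorem commLetterB_apply (c : ℂ) (μ : κ) (a lam : S → 𝔸) (x : S) :
    commLetterB T U c μ a lam x = (I : ℂ) • ad (c • covDstar T U μ a x) (tauB T U μ lam x) := rfl

/-- **`[V¹, ∇_μ] = −ad_{∇_μa}∘τ_μ` as an identity of operators** (forward): `mulLetter a · gradLetterF c μ − gradLetterF c μ ·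
mulLetter a = −commLetterF c μ a` — the lattice Leibniz rule [B8] (1.87) in the letter form consumed by the abstract chain
(`V1 * D − D * V1`). [cite: Balaban1985RegularSpaces, (1.86)–(1.87) p.91; Balaban1985BackgroundPropagators, (3.52) p.400] -/
theorem mul_grad_comm_F (c : ℂ) (μ : κ) (a : S → 𝔸) :
    mulLetter a * gradLetterF T U c μ - gradLetterF T U c μ * mulLetter a = -commLetterF T U c μ a := by
  apply LinearMap.ext
  intro lam
  funext x
  rw [LinearMap.sub_apply, Module.End.mul_apply, Module.End.mul_apply, LinearMap.neg_apply, Pi.sub_apply, Pi.neg_apply,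
    mulLetter_apply, gradLetterF_apply, gradLetterF_apply, commLetterF_apply, ad_smul_covD_eq]
  have hfun : (mulLetter a lam : S → 𝔸) = (I : ℂ) • adOp a lam := by
    funext y; rw [mulLetter_apply, Pi.smul_apply, adOp_apply]
  rw [hfun, covD_smul, smul_sub, smul_comm c (I : ℂ)]
  abel

/-- **`[V¹, ∇*_μ] = −ad_{∇*_μa}∘τ*_μ` as an identity of operators** (backward twin).
[cite: Balaban1985RegularSpaces, (1.86)–(1.87) p.91; Balaban1985BackgroundPropagators, (3.52) p.400] -/
theorem mul_grad_comm_B (c : ℂ) (μ : κ) (a : S → 𝔸) :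
    mulLetter a * gradLetterB T U c μ - gradLetterB T U c μ * mulLetter a = -commLetterB T U c μ a := by
  apply LinearMap.ext
  intro lam
  funext x
  rw [LinearMap.sub_apply, Module.End.mul_apply, Module.End.mul_apply, LinearMap.neg_apply, Pi.sub_apply, Pi.neg_apply,
    mulLetter_apply, gradLetterB_apply, gradLetterB_apply, commLetterB_apply, ad_smul_covDstar_eq]
  have hfun : (mulLetter a lam : S → 𝔸) = (I : ℂ) • adOp a lam := by
    funext y; rw [mulLetter_apply, Pi.smul_apply, adOp_apply]
  rw [hfun, covDstar_smul, smul_sub, smul_comm c (I : ℂ)]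
  abel

/-- **`B9Eq352DivForm.commPart` is the sum of the commutator letters over the bonds of `st(x)`**: forward letters with the
coefficients `A_μ`, backward letters with the transported coefficients `τ*_μA_μ` (with a minus sign), all at `c = η⁻¹`.
[cite: Balaban1985BackgroundPropagators, (3.52) p.400] -/
theorem commPart_eq_sum_letters [Fintype κ] (η : ℝ) (A : κ → S → 𝔸) (lam : S → 𝔸) (x : S) :
    commPart T U η A lam x
      = ∑ μ, (commLetterF T U ((η : ℂ)⁻¹) μ (A μ) lam x - commLetterB T U ((η : ℂ)⁻¹) μ (tauB T U μ (A μ)) lam x) := by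
  simp only [commPart, commLetterF_apply, commLetterB_apply]

end Letters

/-! ## §3  The commutator letters in the block-majorant calculus; `hComm` discharged under (3.37) -/

section Majorants

variable {𝔸 : Type*} [NormedRing 𝔸] [NormedAlgebra ℂ 𝔸] {ι : Type} [Fintype ι] (b : Module.Basis ι ℝ 𝔸)
variable {S : Type} {κ : Type*} (T : κ → Equiv.Perm S) (U : κ → S → 𝔸ˣ)
variable {g : B9.Geometry} [Fintype g.Site] {Rr : ℝ} {H : Prop}

omit [NormedAlgebra ℂ 𝔸] in
/-- Transport size (as `B9Eq370Expansion.norm_R_le`): `‖R(V)Z‖ ≦ ρ²‖Z‖` for `‖V‖, ‖V⁻¹‖ ≦ ρ`. [folklore] -/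
private theorem norm_R_le_sq'' [NormedAlgebra ℂ 𝔸] (V : 𝔸ˣ) {ρ : ℝ} (h1 : ‖(V : 𝔸)‖ ≤ ρ)
    (h2 : ‖((V⁻¹ : 𝔸ˣ) : 𝔸)‖ ≤ ρ) (Z : 𝔸) : ‖R V Z‖ ≤ ρ ^ 2 * ‖Z‖ := by
  have hρ : 0 ≤ ρ := (norm_nonneg _).trans h1
  calc ‖R V Z‖ ≤ ‖(V : 𝔸)‖ * ‖Z‖ * ‖((V⁻¹ : 𝔸ˣ) : 𝔸)‖ := norm_R_le V Z
    _ ≤ ρ * ‖Z‖ * ρ :=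
        mul_le_mul (mul_le_mul_of_nonneg_right h1 (norm_nonneg Z)) h2 (norm_nonneg _) (mul_nonneg hρ (norm_nonneg Z))
    _ = ρ ^ 2 * ‖Z‖ := by ring

omit [Fintype ι] in
/-- `‖i·X‖ = ‖X‖`. [folklore] -/
private theorem norm_I_smul' (X : 𝔸) : ‖(I : ℂ) • X‖ = ‖X‖ := by
  rw [norm_smul, Complex.norm_I, one_mul]

/-- **Pointwise size of the forward commutator letter**: `‖i[(c·D¹_μa)(x), τ_μλ(x)]‖ ≦ 2·ρ²·g·‖λ(x+e_μ)‖` when the coefficient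
difference at `x` has norm `≦ g` and `‖U_μ(x)‖, ‖U_μ(x)⁻¹‖ ≦ ρ` («|∇^η_UA′| < α₁(Lʲη)⁻²», (3.37); `norm_ad_le`).
[cite: Balaban1985BackgroundPropagators, (3.37) p.396 + (3.52) p.400] -/
theorem norm_commLetterF_le (c : ℂ) (μ : κ) (a lam : S → 𝔸) (x : S) {gx ρ : ℝ} (hgx : ‖c • covD T U μ a x‖ ≤ gx)
    (hρ1 : ‖((U μ x : 𝔸ˣ) : 𝔸)‖ ≤ ρ) (hρ2 : ‖(((U μ x)⁻¹ : 𝔸ˣ) : 𝔸)‖ ≤ ρ) :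
    ‖commLetterF T U c μ a lam x‖ ≤ 2 * ρ ^ 2 * gx * ‖lam (T μ x)‖ := by
  rw [commLetterF_apply, norm_I_smul', tauF_apply]
  have hg0 : 0 ≤ gx := (norm_nonneg _).trans hgx
  calc ‖ad (c • covD T U μ a x) (R (U μ x) (lam (T μ x)))‖
      ≤ 2 * ‖c • covD T U μ a x‖ * ‖R (U μ x) (lam (T μ x))‖ := norm_ad_le _ _
    _ ≤ 2 * gx * (ρ ^ 2 * ‖lam (T μ x)‖) := by
        have h2 := norm_R_le_sq'' (U μ x) hρ1 hρ2 (lam (T μ x))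
        gcongr
    _ = 2 * ρ ^ 2 * gx * ‖lam (T μ x)‖ := by ring

/-- **Pointwise size of the backward commutator letter**: `‖i[(c·D¹*_μa)(x), τ*_μλ(x)]‖ ≦ 2·ρ²·g·‖λ(x−e_μ)‖` under the
analogous hypotheses at the bond behind `x` (`U_μ(x−e_μ)`). [cite: Balaban1985BackgroundPropagators, (3.37) p.396 + (3.52) p.400] -/
theorem norm_commLetterB_le (c : ℂ) (μ : κ) (a lam : S → 𝔸) (x : S) {gx ρ : ℝ} (hgx : ‖c • covDstar T U μ a x‖ ≤ gx)
    (hρ1 : ‖(((U μ ((T μ).symm x))⁻¹ : 𝔸ˣ) : 𝔸)‖ ≤ ρ) (hρ2 : ‖((((U μ ((T μ).symm x))⁻¹)⁻¹ : 𝔸ˣ) : 𝔸)‖ ≤ ρ) :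
    ‖commLetterB T U c μ a lam x‖ ≤ 2 * ρ ^ 2 * gx * ‖lam ((T μ).symm x)‖ := by
  rw [commLetterB_apply, norm_I_smul', tauB_apply]
  have hg0 : 0 ≤ gx := (norm_nonneg _).trans hgx
  calc ‖ad (c • covDstar T U μ a x) (R (U μ ((T μ).symm x))⁻¹ (lam ((T μ).symm x)))‖
      ≤ 2 * ‖c • covDstar T U μ a x‖ * ‖R (U μ ((T μ).symm x))⁻¹ (lam ((T μ).symm x))‖ := norm_ad_le _ _
    _ ≤ 2 * gx * (ρ ^ 2 * ‖lam ((T μ).symm x)‖) := by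
        have h2 := norm_R_le_sq'' (U μ ((T μ).symm x))⁻¹ hρ1 hρ2 (lam ((T μ).symm x))
        gcongr
    _ = 2 * ρ ^ 2 * gx * ‖lam ((T μ).symm x)‖ := by ring

/-- **The forward commutator letter as a letter of the block-majorant calculus.**  With the coefficient differences bounded
blockwise (`‖(c·D¹_μa)(x)‖ ≦ gf(y)` for `x ∈ Δ(y)`, `gf ≧ 0`), transports of size `≦ ρ`, neighbouring blocks at `d`-distance
`≦ d₀` (`d(y(x), y(x+e_μ)) ≦ d₀`), coordinate bound `M₂` and any `δ ≧ 0`: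
`conj b (commLetterF c μ a) ≺ 2ρ²·gf(y)·M₂·(Σ_i‖b_i‖)·e^{δd₀}·e^{−δd(y,y′)}`.
[cite: Balaban1984PropagatorsII, (2.51) p.232; Balaban1985BackgroundPropagators, (3.37) p.396 + (3.52) p.400] -/
theorem hasMajorant_commLetterF (blk : S → g.Site) (c : ℂ) (μ : κ) (a : S → 𝔸) (gf : g.Site → ℝ) (ρ d₀ δ M₂ : ℝ)
    (hgf : ∀ y, 0 ≤ gf y) (hδ : 0 ≤ δ) (hM₂ : 0 ≤ M₂) (hrepr : ∀ (v : 𝔸) (i : ι), |b.repr v i| ≤ M₂ * ‖v‖)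
    (hg : ∀ x, ‖c • covD T U μ a x‖ ≤ gf (blk x))
    (hρ : ∀ x, ‖((U μ x : 𝔸ˣ) : 𝔸)‖ ≤ ρ ∧ ‖(((U μ x)⁻¹ : 𝔸ˣ) : 𝔸)‖ ≤ ρ)
    (hd₀ : ∀ x, g.dist (blk x) (blk (T μ x)) ≤ d₀) :
    HasMajorant (g := toB6 g Rr H) (fun p : S × ι => blk p.1) (conj b (commLetterF T U c μ a))
      (fun y y' => (2 * ρ ^ 2 * gf y) * (M₂ * ∑ i, ‖b i‖) * Real.exp (δ * d₀) * Real.exp (-(δ * g.dist y y'))) := by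
  refine hasMajorant_conj_of_local (Rr := Rr) (H := H) b blk (fun x x' => x' = T μ x) (fun y => 2 * ρ ^ 2 * gf y) d₀ δ M₂
    (fun y => by have := hgf y; positivity) hδ hM₂ hrepr (fun x x' hx' => by rw [hx']; exact hd₀ x)
    (commLetterF T U c μ a) ?_
  intro f x B hB
  have hB' : ‖f (T μ x)‖ ≤ B := hB (T μ x) rfl
  have hB0 : 0 ≤ B := (norm_nonneg _).trans hB'
  calc ‖commLetterF T U c μ a f x‖ ≤ 2 * ρ ^ 2 * gf (blk x) * ‖f (T μ x)‖ :=
        norm_commLetterF_le T U c μ a f x (hg x) (hρ x).1 (hρ x).2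
    _ ≤ 2 * ρ ^ 2 * gf (blk x) * B := by
        have : 0 ≤ 2 * ρ ^ 2 * gf (blk x) := by have := hgf (blk x); positivity
        exact mul_le_mul_of_nonneg_left hB' this

/-- **The backward commutator letter as a letter of the block-majorant calculus** (stencil `x − e_μ`, transports
`U_μ(x−e_μ)⁻¹`). [cite: Balaban1984PropagatorsII, (2.51) p.232; Balaban1985BackgroundPropagators, (3.37) p.396 + (3.52) p.400] -/
theorem hasMajorant_commLetterB (blk : S → g.Site) (c : ℂ) (μ : κ) (a : S → 𝔸) (gf : g.Site → ℝ) (ρ d₀ δ M₂ : ℝ)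
    (hgf : ∀ y, 0 ≤ gf y) (hδ : 0 ≤ δ) (hM₂ : 0 ≤ M₂) (hrepr : ∀ (v : 𝔸) (i : ι), |b.repr v i| ≤ M₂ * ‖v‖)
    (hg : ∀ x, ‖c • covDstar T U μ a x‖ ≤ gf (blk x))
    (hρ : ∀ x, ‖(((U μ ((T μ).symm x))⁻¹ : 𝔸ˣ) : 𝔸)‖ ≤ ρ ∧ ‖((((U μ ((T μ).symm x))⁻¹)⁻¹ : 𝔸ˣ) : 𝔸)‖ ≤ ρ)
    (hd₀ : ∀ x, g.dist (blk x) (blk ((T μ).symm x)) ≤ d₀) :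
    HasMajorant (g := toB6 g Rr H) (fun p : S × ι => blk p.1) (conj b (commLetterB T U c μ a))
      (fun y y' => (2 * ρ ^ 2 * gf y) * (M₂ * ∑ i, ‖b i‖) * Real.exp (δ * d₀) * Real.exp (-(δ * g.dist y y'))) := by
  refine hasMajorant_conj_of_local (Rr := Rr) (H := H) b blk (fun x x' => x' = (T μ).symm x) (fun y => 2 * ρ ^ 2 * gf y) d₀
    δ M₂ (fun y => by have := hgf y; positivity) hδ hM₂ hrepr (fun x x' hx' => by rw [hx']; exact hd₀ x)
    (commLetterB T U c μ a) ?_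
  intro f x B hB
  have hB' : ‖f ((T μ).symm x)‖ ≤ B := hB ((T μ).symm x) rfl
  calc ‖commLetterB T U c μ a f x‖ ≤ 2 * ρ ^ 2 * gf (blk x) * ‖f ((T μ).symm x)‖ :=
        norm_commLetterB_le T U c μ a f x (hg x) (hρ x).1 (hρ x).2
    _ ≤ 2 * ρ ^ 2 * gf (blk x) * B := by
        have : 0 ≤ 2 * ρ ^ 2 * gf (blk x) := by have := hgf (blk x); positivity
        exact mul_le_mul_of_nonneg_left hB' this

/-- **`hComm` DISCHARGED for the concrete forward letters under (3.37).**  With `V1 := conj b (mulLetter (A μ))` (the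
coefficient `iad_{A_μ}`) and `D := conj b (gradLetterF η⁻¹ μ)` (`∇_μ`), (3.37) read blockwise — `‖(∇_μA_μ)(x)‖ ≦ α₁(Lʲη)⁻²`
for `x ∈ Δ(y)`, `y ∈ Λ_j` (`g.len y = Lʲη`) —, transports of size `≦ ρ`, neighbouring blocks within `d₀` and `α₁ ≧ 0`:
`V1 * D − D * V1 ≺ c_K·α₁·(Lʲη)⁻²·e^{−δd(y,y′)}`, `c_K = 2ρ²·M₂·(Σ_i‖b_i‖)·e^{δd₀}` — the hypothesis shape `hComm k` of
`B9Ineq386CommSum.thm34_G_entries13_opForm_of_comm_sum` (and of `B9Ineq386RightEntry`/`B9Ineq368PPrimeDs` §5), as a theorem.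
[cite: Balaban1985BackgroundPropagators, (3.37) p.396 + (3.52) p.400 + (3.73) p.405; Balaban1985RegularSpaces, (1.87) p.91; Balaban1984PropagatorsII, (2.51) p.232] -/
theorem hasMajorant_comm_forward (blk : S → g.Site) (η : ℝ) (μ : κ) (A : κ → S → 𝔸) (ρ d₀ δ M₂ α₁ : ℝ)
    (hα₁ : 0 ≤ α₁) (hδ : 0 ≤ δ) (hM₂ : 0 ≤ M₂) (hrepr : ∀ (v : 𝔸) (i : ι), |b.repr v i| ≤ M₂ * ‖v‖)
    (h337 : ∀ x, ‖((η : ℂ)⁻¹) • covD T U μ (A μ) x‖ ≤ α₁ * (g.len (blk x) ^ 2)⁻¹)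
    (hρ : ∀ x, ‖((U μ x : 𝔸ˣ) : 𝔸)‖ ≤ ρ ∧ ‖(((U μ x)⁻¹ : 𝔸ˣ) : 𝔸)‖ ≤ ρ)
    (hd₀ : ∀ x, g.dist (blk x) (blk (T μ x)) ≤ d₀) :
    HasMajorant (g := toB6 g Rr H) (fun p : S × ι => blk p.1)
      (conj b (mulLetter (A μ)) * conj b (gradLetterF T U ((η : ℂ)⁻¹) μ)
        - conj b (gradLetterF T U ((η : ℂ)⁻¹) μ) * conj b (mulLetter (A μ)))
      (fun y y' => (2 * ρ ^ 2 * M₂ * (∑ i, ‖b i‖) * Real.exp (δ * d₀)) * α₁ * (g.len y ^ 2)⁻¹ *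
        Real.exp (-(δ * g.dist y y'))) := by
  -- the operator identity: V1·D − D·V1 = −(commutator letter), pushed through the coordinates
  have hop : conj b (mulLetter (A μ)) * conj b (gradLetterF T U ((η : ℂ)⁻¹) μ)
      - conj b (gradLetterF T U ((η : ℂ)⁻¹) μ) * conj b (mulLetter (A μ))
      = -conj b (commLetterF T U ((η : ℂ)⁻¹) μ (A μ)) := by
    rw [← conj_mul, ← conj_mul, ← conj_sub, mul_grad_comm_F, conj_neg]
  rw [hop]
  have h := hasMajorant_commLetterF (Rr := Rr) (H := H) b T U blk ((η : ℂ)⁻¹) μ (A μ)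
    (fun y => α₁ * (g.len y ^ 2)⁻¹) ρ d₀ δ M₂ (fun y => mul_nonneg hα₁ (inv_nonneg.mpr (sq_nonneg _))) hδ hM₂ hrepr
    h337 hρ hd₀
  refine hasMajorant_mono (g := toB6 g Rr H) _ (hasMajorant_neg (R := Rr) (H := H) _ h) fun y y' => le_of_eq ?_
  ring

/-- **`hComm` DISCHARGED for the concrete backward letters under (3.37)**: `V1 := conj b (mulLetter a)` with the transported
coefficient `a = τ*_μA_μ` of the backward bond, `D := conj b (gradLetterB η⁻¹ μ)` (`∇*_μ`), the starred coefficient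
difference bounded blockwise `‖(∇*_μa)(x)‖ ≦ α₁(Lʲη)⁻²` (it is a doubly transported forward difference two steps back,
`B9Eq352DivForm.norm_covDstar_tauB_le`): `V1 * D − D * V1 ≺ c_K·α₁·(Lʲη)⁻²·e^{−δd}`, same `c_K`.
[cite: Balaban1985BackgroundPropagators, (3.37) p.396 + (3.52) p.400 + (3.73) p.405; Balaban1985RegularSpaces, (1.87) p.91; Balaban1984PropagatorsII, (2.51) p.232] -/
theorem hasMajorant_comm_backward (blk : S → g.Site) (η : ℝ) (μ : κ) (a : S → 𝔸) (ρ d₀ δ M₂ α₁ : ℝ)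
    (hα₁ : 0 ≤ α₁) (hδ : 0 ≤ δ) (hM₂ : 0 ≤ M₂) (hrepr : ∀ (v : 𝔸) (i : ι), |b.repr v i| ≤ M₂ * ‖v‖)
    (h337 : ∀ x, ‖((η : ℂ)⁻¹) • covDstar T U μ a x‖ ≤ α₁ * (g.len (blk x) ^ 2)⁻¹)
    (hρ : ∀ x, ‖(((U μ ((T μ).symm x))⁻¹ : 𝔸ˣ) : 𝔸)‖ ≤ ρ ∧ ‖((((U μ ((T μ).symm x))⁻¹)⁻¹ : 𝔸ˣ) : 𝔸)‖ ≤ ρ)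
    (hd₀ : ∀ x, g.dist (blk x) (blk ((T μ).symm x)) ≤ d₀) :
    HasMajorant (g := toB6 g Rr H) (fun p : S × ι => blk p.1)
      (conj b (mulLetter a) * conj b (gradLetterB T U ((η : ℂ)⁻¹) μ)
        - conj b (gradLetterB T U ((η : ℂ)⁻¹) μ) * conj b (mulLetter a))
      (fun y y' => (2 * ρ ^ 2 * M₂ * (∑ i, ‖b i‖) * Real.exp (δ * d₀)) * α₁ * (g.len y ^ 2)⁻¹ *
        Real.exp (-(δ * g.dist y y'))) := by
  have hop : conj b (mulLetter a) * conj b (gradLetterB T U ((η : ℂ)⁻¹) μ)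
      - conj b (gradLetterB T U ((η : ℂ)⁻¹) μ) * conj b (mulLetter a)
      = -conj b (commLetterB T U ((η : ℂ)⁻¹) μ a) := by
    rw [← conj_mul, ← conj_mul, ← conj_sub, mul_grad_comm_B, conj_neg]
  rw [hop]
  have h := hasMajorant_commLetterB (Rr := Rr) (H := H) b T U blk ((η : ℂ)⁻¹) μ a
    (fun y => α₁ * (g.len y ^ 2)⁻¹) ρ d₀ δ M₂ (fun y => mul_nonneg hα₁ (inv_nonneg.mpr (sq_nonneg _))) hδ hM₂ hrepr
    h337 hρ hd₀
  refine hasMajorant_mono (g := toB6 g Rr H) _ (hasMajorant_neg (R := Rr) (H := H) _ h) fun y y' => le_of_eq ?_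
  ring

/-- **The coefficient letter `V¹ = iad_{A}` in the block-majorant calculus** (block-diagonal: stencil `{x}`): under (3.37)
read blockwise, `‖A_μ(x)‖ ≦ α₁(Lʲη)⁻¹` for `x ∈ Δ(y)`: `conj b (mulLetter (A μ)) ≺ 2M₂(Σ_i‖b_i‖)·α₁(Lʲη)⁻¹·𝟙[y = y′]` — the
shape of the letters `V1 k` up to the cell's convention `𝟙[y = y′] ≦ e^{−δd(y,y′)}` at `d(y,y) = 0`.
[cite: Balaban1985BackgroundPropagators, (3.37) p.396 + (3.52) p.400 + (3.73) p.405; Balaban1984PropagatorsII, (2.51) p.232] -/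
theorem hasMajorant_mulLetter [DecidableEq g.Site] (blk : S → g.Site) (μ : κ) (A : κ → S → 𝔸) (M₂ α₁ : ℝ)
    (hα₁ : 0 ≤ α₁) (hM₂ : 0 ≤ M₂) (hrepr : ∀ (v : 𝔸) (i : ι), |b.repr v i| ≤ M₂ * ‖v‖)
    (hlen : ∀ y : g.Site, 0 < g.len y) (h337 : ∀ x, ‖A μ x‖ ≤ α₁ * (g.len (blk x))⁻¹) :
    HasMajorant (g := toB6 g Rr H) (fun p : S × ι => blk p.1) (conj b (mulLetter (A μ)))
      (fun y y' : g.Site => if y = y' then (2 * α₁ * (g.len y)⁻¹) * (M₂ * ∑ i, ‖b i‖) else 0) := by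
  refine hasMajorant_conj_of_local' (Rr := Rr) (H := H) b blk (fun x x' => x' = x) (fun y => 2 * α₁ * (g.len y)⁻¹) M₂ hM₂
    hrepr (fun x x' hx' => by rw [hx']) (mulLetter (A μ)) ?_
  intro f x B hB
  have hB' : ‖f x‖ ≤ B := hB x rfl
  rw [mulLetter_apply, norm_I_smul']
  calc ‖ad (A μ x) (f x)‖ ≤ 2 * ‖A μ x‖ * ‖f x‖ := norm_ad_le _ _
    _ ≤ 2 * (α₁ * (g.len (blk x))⁻¹) * B := by
        have h0 : 0 ≤ α₁ * (g.len (blk x))⁻¹ := mul_nonneg hα₁ (inv_nonneg.mpr (hlen _).le)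
        have := h337 x
        gcongr
    _ = 2 * α₁ * (g.len (blk x))⁻¹ * B := by ring

end Majorants

end Literature.MathematicalPhysics.QuantumFieldTheory.Balaban1983to89.B9Eq352DivFormLetters
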